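import Summits.AtomisticToContinuum.FouriersLaw.Theorems.OddSectorIrreversibilityCorrectorTheoryUniformMixing

/-!
# `StieltjesRepresentation` (stmt-AtomisticToContinuum-15248) · stub `stub_mixedEdges` · Aux2: (CONT) from (UH), and (UH),
# for `lam ≥ 0`

Helper file (`--supports`) for the crux `ContactStieltjesMeasure.StieltjesRepresentation`
(stmt-AtomisticToContinuum-15248), line `cayley-pencil`, stub `stub_mixedEdges` (the mixed edges `lam · β = 0 < lam + β`
of the crux's parameter square). Outcome of the stub's triage for the edge `lam = 0 < β` (harmonic pinning `ω₂ q²/2`,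
FPU-`β` coupling `r²/2 + β r⁴/4`; Cuneo–Eckmann–Hairer–Rey-Bellet conditions C1–C5 hold with `ℓ_p = 2 ≤ ℓ_i = 4`): it is
NOT an edge of the tree's fixed-`N` theory — the route item `HonestZwanzig.OpenChainGreenKubo` (stmt-12696) is STATED for
`0 < lam`, but the whole dependency cone of its proof `OddSectorIrreversibility.Corrector.openChainGreenKubo_holds` uses the
quartic pinning only through `0 ≤ lam` (`hl.le` at every use site; the named fact `CuneoEckmannHairerReyBellet2018_H2` is
stated and proved for `lam ≥ 0`). The three files `…StubMixedEdgesAux1` (★), `…StubMixedEdgesAux2` ((CONT), (UH)) and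
`…StubMixedEdges` (skeleton and conclusion) re-elaborate the members of that cone whose section variable reads
`(hl : 0 < lam)` with `(hl : 0 ≤ lam)`; proof bodies are those of the tree files (items stmt-12696 / stmt-14071) with
`hl.le ↦ hl`, declarations suffixed `_nn`. No definitions, no named facts, no new hypotheses.

This file: (CONT) from (UH) (`…HonestZwanzigOpenChainGreenKuboUniformDecay`) for `lam ≥ 0` —
`integral_source_gibbsMeasure_nn`, `tendsto_pairing_of_uniform_decay_nn`; and (UH) itself, the uniform-in-`δ` CEHR (2.5)
for the forecast of the total current (`uniformDecay_totalCurrent` of `…CorrectorTheoryUniformMixing`, whose proof already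
ran at `0 ≤ lam` through `pinnedChain_uniformMixing`) — `uniformDecay_totalCurrent_nn`.
-/

noncomputable section

open MeasureTheory ProbabilityTheory Filter Topology Set Metric
open scoped NNReal ENNReal ContDiff BigOperators

namespace Summit.AtomisticToContinuum.FouriersLaw.Theorems.ContactStieltjesMeasure.CayleyPencil

open Literature.MathematicalPhysics.KineticTheory.HeatConduction
open Literature.MathematicalPhysics.KineticTheory OscillatorChain
open Literature.Probability.Process
open Summit.AtomisticToContinuum.FouriersLaw.Theorems.OddSectorIrreversibility.Corrector
open Summit.AtomisticToContinuum.FouriersLaw.Theorems.OpenChainGreenKubo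

variable {N : ℕ}

section ContNN

variable {ω₂ lam β γ : ℝ} (hω : 0 < ω₂)
include hω

/-- `μ_T(g · 1) = 0`: the KDN source has zero Gibbs mean (the odd Gibbs moment vanishes,
`integral_gibbsWeight_oddMoment_eq_zero`). [folklore] -/
theorem integral_source_gibbsMeasure_nn
    (hl : 0 ≤ lam) (hβ : 0 < β) (hγ : 0 < γ) (hN : 2 ≤ N) {T : ℝ} (hT : 0 < T) :
    ∫ x, γ / 2 * (x.2 ⟨0, by omega⟩ ^ 2 - x.2 ⟨N - 1, by omega⟩ ^ 2) * (fun _ => (1 : ℝ)) x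
      ∂((pinnedChain ω₂ lam β γ).gibbsMeasure N T) = 0 := by
  have hN0 : 0 < N := by omega
  have hTL : 0 < T + T / 2 := by linarith
  have hTR : 0 < T - T / 2 := by linarith
  have hmax : 0 < 1 / max (T + T / 2) (T - T / 2) := by positivity
  have h0 := integral_gibbsWeight_oddMoment_eq_zero hω hl hβ.le hγ hN0 hT hTL hTR (half_pos hmax)
    (half_lt_self hmax) hT.ne'
  rw [integral_source_mul_eq (pinnedChain ω₂ lam β γ) hN γ T]
  simp only [one_mul]
  rw [h0, mul_zero, mul_zero]

/-- **(CONT) from a uniform exponential relaxation of the current forecast (UH).** If for some `δ₀, ϑ, C, c > 0`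
(`ϑ < 1/T`) and every `|δ| ≤ δ₀` the forecast of `J` under the kernels at `(T+δ/2, T-δ/2)` satisfies
`|P^δ_t J(z) - m_δ| ≤ C e^{ϑH(z)} e^{-ct}` for some constant `m_δ`, then
`δ ↦ ∫₀^∞ ∫ g (P^δ_s J) dμ_T ds` is continuous at `0` along `δ ≠ 0` (indeed along `δ → 0`).
[cite: CuneoEckmannHairerReyBellet2018, Thm 2.13 eq. (2.5)] -/
theorem tendsto_pairing_of_uniform_decay_nn
    (hl : 0 ≤ lam) (hβ : 0 < β) (hγ : 0 < γ) (hN : 2 ≤ N) {T : ℝ} (hT : 0 < T)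
    (hUH : ∃ δ₀ ϑ C c : ℝ, 0 < δ₀ ∧ 0 < ϑ ∧ ϑ < 1 / T ∧ 0 < c ∧ ∀ δ : ℝ, |δ| ≤ δ₀ → ∃ m : ℝ,
      ∀ (z : PhaseSpace N) (t : ℝ≥0),
        |(∫ y, (∑ i : Fin N, (pinnedChain ω₂ lam β γ).bondCurrent N i y)
            ∂((pinnedChain ω₂ lam β γ).transitionKernel N (T + δ / 2) (T - δ / 2) t z)) - m| ≤
          C * Real.exp (ϑ * (pinnedChain ω₂ lam β γ).hamiltonian N z) * Real.exp (-c * t)) :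
    Tendsto (fun δ : ℝ => ∫ s in Ioi (0 : ℝ), ∫ x,
        γ / 2 * (x.2 ⟨0, by omega⟩ ^ 2 - x.2 ⟨N - 1, by omega⟩ ^ 2) *
          (∫ y, (∑ i : Fin N, (pinnedChain ω₂ lam β γ).bondCurrent N i y)
            ∂((pinnedChain ω₂ lam β γ).transitionKernel N (T + δ / 2) (T - δ / 2) s.toNNReal x))
        ∂((pinnedChain ω₂ lam β γ).gibbsMeasure N T))
      (𝓝[≠] 0)
      (𝓝 (∫ s in Ioi (0 : ℝ), ∫ x,
        γ / 2 * (x.2 ⟨0, by omega⟩ ^ 2 - x.2 ⟨N - 1, by omega⟩ ^ 2) *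
          (∫ y, (∑ i : Fin N, (pinnedChain ω₂ lam β γ).bondCurrent N i y)
            ∂((pinnedChain ω₂ lam β γ).transitionKernel N T T s.toNNReal x))
        ∂((pinnedChain ω₂ lam β γ).gibbsMeasure N T))) := by
  obtain ⟨δ₀, ϑ, C, c, hδ₀, hϑ, hϑT, hc, hU⟩ := hUH
  set P := pinnedChain ω₂ lam β γ with hP
  set μ := P.gibbsMeasure N T with hμ
  have hN0 : 0 < N := by omega
  haveI : IsProbabilityMeasure μ := pinnedChain_isProbabilityMeasure_gibbsMeasure hω hl hβ.le γ N hT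
  set J : PhaseSpace N → ℝ := fun y => ∑ i : Fin N, P.bondCurrent N i y with hJ
  set gK : PhaseSpace N → ℝ := fun x => γ / 2 * (x.2 ⟨0, by omega⟩ ^ 2 - x.2 ⟨N - 1, by omega⟩ ^ 2) with hgK
  have hJc : Continuous J := continuous_totalBondCurrent ω₂ lam β γ N
  have hJ2 : ContDiff ℝ 2 J := (contDiff_totalBondCurrent ω₂ lam β γ N).of_le (by norm_cast)
  have hgc : Continuous gK := continuous_const.mul
    ((((continuous_apply _).comp continuous_snd).pow 2).sub (((continuous_apply _).comp continuous_snd).pow 2))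
  have hC0 : 0 ≤ C := by
    obtain ⟨m, hm⟩ := hU 0 (by rw [abs_zero]; exact hδ₀.le)
    have h := hm 0 0
    have : 0 ≤ C * Real.exp (ϑ * P.hamiltonian N 0) * Real.exp (-c * ((0 : ℝ≥0) : ℝ)) := (abs_nonneg _).trans h
    have h2 : 0 < Real.exp (ϑ * P.hamiltonian N 0) * Real.exp (-c * ((0 : ℝ≥0) : ℝ)) := by positivity
    nlinarith
  -- a small exponent for the current and the source
  set ϑ₂ : ℝ := min (1 / T / 4) ((1 / T - ϑ) / 2) with hϑ₂
  have hT1 : 0 < 1 / T := by positivity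
  have hϑ₂0 : 0 < ϑ₂ := lt_min (by positivity) (by linarith)
  have hϑ₂1 : ϑ₂ ≤ 1 / T / 4 := min_le_left _ _
  have hϑ₂2 : ϑ₂ ≤ (1 / T - ϑ) / 2 := min_le_right _ _
  have h2ϑ₂ : 2 * ϑ₂ < 1 / T := by linarith
  have hsum : ϑ + ϑ₂ < 1 / T := by linarith
  obtain ⟨M, hM0, hJM⟩ := abs_totalBondCurrent_le_exp hω.le hl hβ.le γ N hϑ₂0
  obtain ⟨Cg, hCg0, hgb⟩ : ∃ Cg : ℝ, 0 ≤ Cg ∧ ∀ y, |gK y| ≤ Cg * Real.exp (ϑ₂ * P.hamiltonian N y) := by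
    refine ⟨|γ| / 1 ^ 2 * (2 * Real.exp ϑ₂ / ϑ₂ ^ 2), by positivity, fun y => ?_⟩
    have h := OddSectorIrreversibility.pinnedChain_abs_mclennanSource_le hω hl hβ.le N (γ := γ) (T := 1) hϑ₂0
      ⟨0, by omega⟩ ⟨N - 1, by omega⟩ y
    have e : γ / (2 * (1 : ℝ) ^ 2) = γ / 2 := by norm_num
    rw [e] at h
    exact h
  -- integrable weights
  have hexpsum := pinnedChain_integrable_exp_mul_hamiltonian_gibbsMeasure hω hl hβ.le γ N hT hsum
  have hexp2 := pinnedChain_integrable_exp_mul_hamiltonian_gibbsMeasure hω hl hβ.le γ N hT h2ϑ₂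
  have hHc : Continuous (P.hamiltonian N) := (pinnedChain_contDiff_hamiltonian ω₂ lam β γ N (n := 0)).continuous
  have hgexp : Integrable (fun x => |gK x| * Real.exp (ϑ * P.hamiltonian N x)) μ := by
    refine (hexpsum.const_mul Cg).mono'
      (hgc.abs.mul (Real.continuous_exp.comp (continuous_const.mul hHc))).aestronglyMeasurable
      (Eventually.of_forall fun x => ?_)
    rw [Real.norm_eq_abs, abs_mul, abs_abs, abs_of_pos (Real.exp_pos _), add_mul, Real.exp_add]
    calc |gK x| * Real.exp (ϑ * P.hamiltonian N x) ≤ Cg * Real.exp (ϑ₂ * P.hamiltonian N x) * Real.exp (ϑ * P.hamiltonian N x) :=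
        mul_le_mul_of_nonneg_right (hgb x) (Real.exp_pos _).le
      _ = Cg * (Real.exp (ϑ * P.hamiltonian N x) * Real.exp (ϑ₂ * P.hamiltonian N x)) := by ring
  have hgint : Integrable gK μ := by
    refine (hexp2.const_mul Cg).mono' hgc.aestronglyMeasurable (Eventually.of_forall fun x => ?_)
    rw [Real.norm_eq_abs]
    refine (hgb x).trans (mul_le_mul_of_nonneg_left (Real.exp_le_exp.2 ?_) hCg0)
    have := pinnedChain_hamiltonian_nonneg hω.le hl hβ.le γ N x
    nlinarith
  -- `μ_T(g) = 0`
  have hg0 : ∫ x, gK x ∂μ = 0 := by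
    have h := integral_source_gibbsMeasure_nn hω hl hβ hγ hN hT
    simp only [mul_one] at h
    exact h
  -- the pairings `k δ s`
  set k : ℝ → ℝ → ℝ := fun δ s => ∫ x, gK x *
    (∫ y, J y ∂(P.transitionKernel N (T + δ / 2) (T - δ / 2) s.toNNReal x)) ∂μ with hk
  -- (b) the uniform majorant
  set K₀ : ℝ := C * ∫ x, |gK x| * Real.exp (ϑ * P.hamiltonian N x) ∂μ with hK₀
  have hdom : ∀ δ : ℝ, |δ| ≤ δ₀ → ∀ s : ℝ, 0 < s → |k δ s| ≤ K₀ * Real.exp (-c * s) := by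
    intro δ hδ s hs
    obtain ⟨m, hm⟩ := hU δ hδ
    have hfm : Measurable fun x => ∫ y, J y ∂(P.transitionKernel N (T + δ / 2) (T - δ / 2) s.toNNReal x) :=
      pinnedChain_measurable_integral_kernel N _ _ hJc.stronglyMeasurable _
    have hmeas : AEStronglyMeasurable (fun x => gK x *
        ∫ y, J y ∂(P.transitionKernel N (T + δ / 2) (T - δ / 2) s.toNNReal x)) μ :=
      (hgc.aestronglyMeasurable).mul hfm.aestronglyMeasurable
    have hbd : ∀ x, |gK x * ((∫ y, J y ∂(P.transitionKernel N (T + δ / 2) (T - δ / 2) s.toNNReal x)) - m)| ≤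
        C * Real.exp (-c * s) * (|gK x| * Real.exp (ϑ * P.hamiltonian N x)) := fun x => by
      rw [abs_mul]
      have h := hm x s.toNNReal
      rw [Real.coe_toNNReal _ hs.le] at h
      calc |gK x| * |(∫ y, J y ∂(P.transitionKernel N (T + δ / 2) (T - δ / 2) s.toNNReal x)) - m|
          ≤ |gK x| * (C * Real.exp (ϑ * P.hamiltonian N x) * Real.exp (-c * s)) :=
            mul_le_mul_of_nonneg_left h (abs_nonneg _)
        _ = _ := by ring
    have hint1 : Integrable (fun x => gK x *
        ((∫ y, J y ∂(P.transitionKernel N (T + δ / 2) (T - δ / 2) s.toNNReal x)) - m)) μ :=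
      ((hgexp.const_mul (C * Real.exp (-c * s))).mono'
        (hgc.aestronglyMeasurable.mul (hfm.aestronglyMeasurable.sub aestronglyMeasurable_const))
        (Eventually.of_forall fun x => by rw [Real.norm_eq_abs]; exact hbd x))
    have hsplit : k δ s = ∫ x, gK x *
        ((∫ y, J y ∂(P.transitionKernel N (T + δ / 2) (T - δ / 2) s.toNNReal x)) - m) ∂μ := by
      have e : (fun x => gK x * ((∫ y, J y ∂(P.transitionKernel N (T + δ / 2) (T - δ / 2) s.toNNReal x)) - m)) =
          fun x => gK x * (∫ y, J y ∂(P.transitionKernel N (T + δ / 2) (T - δ / 2) s.toNNReal x)) - m * gK x := by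
        funext x; ring
      have hint0 : Integrable (fun x => gK x *
          (∫ y, J y ∂(P.transitionKernel N (T + δ / 2) (T - δ / 2) s.toNNReal x))) μ := by
        have := hint1.add ((hgint.const_mul m))
        refine this.congr (Eventually.of_forall fun x => ?_)
        simp only [Pi.add_apply]; ring
      rw [hk]; simp only
      rw [e, integral_sub hint0 (hgint.const_mul m), integral_const_mul, hg0, mul_zero, sub_zero]
    rw [hsplit]
    calc |∫ x, gK x * ((∫ y, J y ∂(P.transitionKernel N (T + δ / 2) (T - δ / 2) s.toNNReal x)) - m) ∂μ|
        ≤ ∫ x, |gK x * ((∫ y, J y ∂(P.transitionKernel N (T + δ / 2) (T - δ / 2) s.toNNReal x)) - m)| ∂μ :=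
          abs_integral_le_integral_abs
      _ ≤ ∫ x, C * Real.exp (-c * s) * (|gK x| * Real.exp (ϑ * P.hamiltonian N x)) ∂μ :=
          integral_mono_of_nonneg (Eventually.of_forall fun x => abs_nonneg _) (hgexp.const_mul _) (Eventually.of_forall hbd)
      _ = K₀ * Real.exp (-c * s) := by rw [integral_const_mul, hK₀]; ring
  -- (c) pointwise continuity in `δ` at every `s`
  have hpt : ∀ s : ℝ, Tendsto (fun δ => k δ s) (𝓝 0) (𝓝 (∫ x, gK x *
      (∫ y, J y ∂(P.transitionKernel N T T s.toNNReal x)) ∂μ)) := by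
    intro s
    have hϑ₂' : ∀ δ : ℝ, |δ| < T → ϑ₂ < 1 / max (T + δ / 2) (T - δ / 2) := by
      intro δ hδ
      have hδ' := abs_lt.1 hδ
      have hm : max (T + δ / 2) (T - δ / 2) < 2 * T := max_lt (by linarith) (by linarith)
      have hmpos : 0 < max (T + δ / 2) (T - δ / 2) := lt_max_of_lt_left (by linarith)
      have h14 : 1 / T / 4 < 1 / (2 * T) := by
        rw [div_div]
        exact one_div_lt_one_div_of_lt (by positivity) (by linarith)
      calc ϑ₂ ≤ 1 / T / 4 := hϑ₂1
        _ < 1 / (2 * T) := h14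
        _ ≤ 1 / max (T + δ / 2) (T - δ / 2) := one_div_le_one_div_of_le hmpos hm.le
    refine tendsto_integral_filter_of_dominated_convergence
      (fun x => |gK x| * (M * (Real.exp (ϑ₂ * γ * (2 * T) * s.toNNReal) * Real.exp (ϑ₂ * P.hamiltonian N x)))) ?_ ?_ ?_ ?_
    · refine Eventually.of_forall fun δ => ?_
      have hfm : Measurable fun x => ∫ y, J y ∂(P.transitionKernel N (T + δ / 2) (T - δ / 2) s.toNNReal x) :=
        pinnedChain_measurable_integral_kernel N _ _ hJc.stronglyMeasurable _
      exact (hgc.aestronglyMeasurable).mul hfm.aestronglyMeasurable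
    · have hball : ∀ᶠ δ : ℝ in 𝓝 0, |δ| < T := by
        have : ∀ᶠ δ : ℝ in 𝓝 0, δ ∈ Ioo (-T) T := Ioo_mem_nhds (by linarith) hT
        filter_upwards [this] with δ hδ using abs_lt.2 ⟨hδ.1, hδ.2⟩
      filter_upwards [hball] with δ hδ
      have hδ' := abs_lt.1 hδ
      have hTL : 0 < T + δ / 2 := by linarith
      have hTR : 0 < T - δ / 2 := by linarith
      refine Eventually.of_forall fun x => ?_
      rw [Real.norm_eq_abs, abs_mul]
      refine mul_le_mul_of_nonneg_left ?_ (abs_nonneg _)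
      have h := pinnedChain_abs_integral_kernel_le' hω hl hβ.le hγ hN0 hTL hTR hϑ₂0 (hϑ₂' δ hδ) hJM s.toNNReal x
      have e : T + δ / 2 + (T - δ / 2) = 2 * T := by ring
      rw [e] at h
      exact h
    · exact ((hexp2.const_mul (Cg * (M * Real.exp (ϑ₂ * γ * (2 * T) * s.toNNReal)))).mono'
        (hgc.abs.mul (continuous_const.mul (continuous_const.mul
          (Real.continuous_exp.comp (continuous_const.mul hHc))))).aestronglyMeasurable
        (Eventually.of_forall fun x => by
          rw [Real.norm_eq_abs, abs_mul, abs_abs,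
            abs_of_nonneg (by positivity : (0 : ℝ) ≤ M * (Real.exp (ϑ₂ * γ * (2 * T) * s.toNNReal) *
              Real.exp (ϑ₂ * P.hamiltonian N x))),
            show 2 * ϑ₂ * P.hamiltonian N x = ϑ₂ * P.hamiltonian N x + ϑ₂ * P.hamiltonian N x by ring, Real.exp_add]
          calc |gK x| * (M * (Real.exp (ϑ₂ * γ * (2 * T) * s.toNNReal) * Real.exp (ϑ₂ * P.hamiltonian N x)))
              ≤ Cg * Real.exp (ϑ₂ * P.hamiltonian N x) *
                (M * (Real.exp (ϑ₂ * γ * (2 * T) * s.toNNReal) * Real.exp (ϑ₂ * P.hamiltonian N x))) :=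
                mul_le_mul_of_nonneg_right (hgb x) (by positivity)
            _ = _ := by ring))
    · exact Eventually.of_forall fun x =>
        (pinnedChain_tendsto_integral_kernel_temps hω hl hβ.le hγ hN0 hT hϑ₂0 h2ϑ₂ hJc hJM s.toNNReal x).const_mul _
  -- (d) dominated convergence in `s`
  have hmeas : ∀ δ : ℝ, AEStronglyMeasurable (k δ) (volume.restrict (Ioi (0 : ℝ))) := by
    intro δ
    have hm := measurable_oddMoment_pairing hω hl hβ.le hγ hN0 (T := T) (δ := δ) hJ2
    have e : k δ = fun s => (∫ x, Real.exp (-1 / T * P.hamiltonian N x))⁻¹ * (γ / 2 *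
        ∫ x, (∫ y, J y ∂(P.transitionKernel N (T + δ / 2) (T - δ / 2) s.toNNReal x)) *
          (Real.exp (-1 / T * P.hamiltonian N x) * (x.2 ⟨0, hN0⟩ ^ 2 - x.2 ⟨N - 1, by omega⟩ ^ 2))) := by
      funext s
      rw [hk]
      exact integral_source_mul_eq P hN γ T _
    rw [e]
    exact ((hm.const_mul _).const_mul _).aestronglyMeasurable
  have hev : ∀ᶠ δ : ℝ in 𝓝[≠] (0 : ℝ), |δ| ≤ δ₀ := by
    have : ∀ᶠ δ : ℝ in 𝓝 0, δ ∈ Icc (-δ₀) δ₀ := Icc_mem_nhds (by linarith) hδ₀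
    exact mem_nhdsWithin_of_mem_nhds (this.mono fun δ hδ => abs_le.2 ⟨hδ.1, hδ.2⟩)
  have hlim := tendsto_integral_filter_of_dominated_convergence (μ := volume.restrict (Ioi (0 : ℝ)))
    (l := 𝓝[≠] (0 : ℝ)) (F := fun δ s => k δ s) (fun s => K₀ * Real.exp (-c * s))
    (Eventually.of_forall hmeas)
    (hev.mono fun δ hδ => (ae_restrict_iff' measurableSet_Ioi).2 (Eventually.of_forall fun s hs => by
      rw [Real.norm_eq_abs]; exact hdom δ hδ s hs))
    ((exp_neg_integrableOn_Ioi 0 hc).const_mul K₀)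
    (Eventually.of_forall fun s => (hpt s).mono_left nhdsWithin_le_nhds)
  exact hlim

end ContNN

/-- **(UH) — the uniform relaxation of the forecast of the total current**, the hypothesis of
`OpenChainGreenKubo.openChainGreenKubo_of_uniformDecay_nn`: for all parameters `> 0`, `T > 0`, `N ≥ 2`
there are `δ₀, ϑ, C, c > 0` (`ϑ < 1/T`) such that for every `|δ| ≤ δ₀`,
`|P^δ_t J(z) - m_δ| ≤ C e^{ϑH(z)} e^{-ct}` with `m_δ` the mean of `J` in the (CEHR) invariant
probability measure of the kernels with baths at `T ± δ/2`.
[cite: CuneoEckmannHairerReyBellet2018, Thm 2.13 eq. (2.5)] -/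
theorem uniformDecay_totalCurrent_nn :
    ∀ ω₂ lam β γ : ℝ, 0 < ω₂ → 0 ≤ lam → 0 < β → 0 < γ →
      ∀ T : ℝ, 0 < T → ∀ N : ℕ, 2 ≤ N →
        ∃ δ₀ ϑ C c : ℝ, 0 < δ₀ ∧ 0 < ϑ ∧ ϑ < 1 / T ∧ 0 < c ∧ ∀ δ : ℝ, |δ| ≤ δ₀ → ∃ m : ℝ,
          ∀ (z : PhaseSpace N) (t : ℝ≥0),
            |(∫ y, (∑ i : Fin N, (pinnedChain ω₂ lam β γ).bondCurrent N i y)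
                ∂((pinnedChain ω₂ lam β γ).transitionKernel N (T + δ / 2) (T - δ / 2) t z)) - m| ≤
              C * Real.exp (ϑ * (pinnedChain ω₂ lam β γ).hamiltonian N z) * Real.exp (-c * t) := by
  intro ω₂ lam β γ hω hl hβ hγ T hT N hN
  have hN0 : 0 < N := by omega
  obtain ⟨δ₀, ϑ, Cm, c, hδ₀, hδ₀T, hϑ0, hϑT, h2ϑ, hCm, hc, hUM⟩ :=
    pinnedChain_uniformMixing (N := N) hω hl hβ hγ hN0 hT
  have hϑT1 : ϑ < 1 / T := hϑT.trans_le (one_div_le_one_div_of_le hT (by linarith))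
  obtain ⟨M, hM0, hM⟩ := abs_totalBondCurrent_le_exp hω.le hl hβ.le γ N hϑ0
  set M₁ : ℝ := M + 1 with hM₁
  have hM₁ : 0 < M₁ := by positivity
  refine ⟨δ₀ / 2, ϑ, M₁ * Cm, c, by positivity, hϑ0, hϑT1, hc, fun δ hδ => ?_⟩
  have hδ' : |δ| < δ₀ := by linarith
  have h1 := abs_lt.1 hδ'
  have hL : 0 < T + δ / 2 := by linarith
  have hR : 0 < T - δ / 2 := by linarith
  -- an invariant probability measure of the kernels at `(T + δ/2, T - δ/2)`
  obtain ⟨-, μs, hμs, hinv, -⟩ := pinnedChainSemigroup_ergodic hω hl hβ hγ hN0 hL hR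
  haveI := hμs
  let J : PhaseSpace N → ℝ := fun y => ∑ i : Fin N, (pinnedChain ω₂ lam β γ).bondCurrent N i y
  let f : PhaseSpace N → ℝ := fun y => M₁⁻¹ * J y
  have hJf : ∀ y, J y = M₁ * f y := fun y => by
    show J y = M₁ * (M₁⁻¹ * J y)
    rw [← mul_assoc, mul_inv_cancel₀ hM₁.ne', one_mul]
  have hfc : Continuous f := continuous_const.mul (continuous_totalBondCurrent ω₂ lam β γ N)
  have hfb : ∀ y, |f y| ≤ Real.exp (ϑ * (pinnedChain ω₂ lam β γ).hamiltonian N y) := by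
    intro y
    show |M₁⁻¹ * J y| ≤ _
    rw [abs_mul, abs_of_pos (inv_pos.2 hM₁)]
    calc M₁⁻¹ * |J y| ≤ M₁⁻¹ * (M * Real.exp (ϑ * (pinnedChain ω₂ lam β γ).hamiltonian N y)) :=
          mul_le_mul_of_nonneg_left (hM y) (inv_pos.2 hM₁).le
      _ = (M₁⁻¹ * M) * Real.exp (ϑ * (pinnedChain ω₂ lam β γ).hamiltonian N y) := by ring
      _ ≤ 1 * Real.exp (ϑ * (pinnedChain ω₂ lam β γ).hamiltonian N y) := by
          refine mul_le_mul_of_nonneg_right ?_ (Real.exp_pos _).le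
          rw [inv_mul_le_iff₀ hM₁]; linarith
      _ = _ := one_mul _
  have hinv' : ∀ t : ℝ≥0, μs.bind ((pinnedChain ω₂ lam β γ).transitionKernel N (T + δ / 2) (T - δ / 2) t) = μs :=
    fun t => hinv t
  refine ⟨∫ y, J y ∂μs, fun z t => ?_⟩
  have h := hUM δ hδ' μs hμs hinv' z t f hfc hfb
  have e1 : (∫ y, J y ∂((pinnedChain ω₂ lam β γ).transitionKernel N (T + δ / 2) (T - δ / 2) t z)) =
      M₁ * ∫ y, f y ∂((pinnedChain ω₂ lam β γ).transitionKernel N (T + δ / 2) (T - δ / 2) t z) := by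
    rw [← integral_const_mul]; exact integral_congr_ae (Eventually.of_forall hJf)
  have e2 : (∫ y, J y ∂μs) = M₁ * ∫ y, f y ∂μs := by
    rw [← integral_const_mul]; exact integral_congr_ae (Eventually.of_forall hJf)
  show |(∫ y, J y ∂((pinnedChain ω₂ lam β γ).transitionKernel N (T + δ / 2) (T - δ / 2) t z)) - ∫ y, J y ∂μs| ≤ _
  rw [e1, e2, ← mul_sub, abs_mul, abs_of_pos hM₁, mul_assoc, mul_assoc]
  exact mul_le_mul_of_nonneg_left (by rw [← mul_assoc]; exact h) hM₁.le

/-- Registered sub-goal `stub_mixedEdges_uniformDecayNonneg` of the crux (this file's ticket): (UH) for `lam ≥ 0` — the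
uniform-in-`δ` exponential relaxation of the forecast of the total current under the kernels with baths at `T ± δ/2`.
[cite: CuneoEckmannHairerReyBellet2018, Thm 2.13 eq. (2.5)] -/
theorem stub_mixedEdges_uniformDecayNonneg :
    ∀ ω₂ lam β γ : ℝ, 0 < ω₂ → 0 ≤ lam → 0 < β → 0 < γ → ∀ T : ℝ, 0 < T → ∀ N : ℕ, 2 ≤ N → ∃ δ₀ ϑ C c : ℝ, 0 < δ₀ ∧ 0 < ϑ ∧ ϑ < 1 / T ∧ 0 < c ∧ ∀ δ : ℝ, |δ| ≤ δ₀ → ∃ m : ℝ, ∀ (z : PhaseSpace N) (t : ℝ≥0), |(∫ y, (∑ i : Fin N, (pinnedChain ω₂ lam β γ).bondCurrent N i y) ∂((pinnedChain ω₂ lam β γ).transitionKernel N (T + δ / 2) (T - δ / 2) t z)) - m| ≤ C * Real.exp (ϑ * (pinnedChain ω₂ lam β γ).hamiltonian N z) * Real.exp (-c * t) :=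
  uniformDecay_totalCurrent_nn

end Summit.AtomisticToContinuum.FouriersLaw.Theorems.ContactStieltjesMeasure.CayleyPencil

end
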